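import Mathlib

/-!
# Crux `UniformPhotonSphereChannelsR` (K1R, stmt-FinalStateConjecture-14074), line
# `crum-peeling-recessive-tower` — helper A0 for `stub_coeffMajorant`: the rung-0 coefficient array
# is majorised by `(1/5)·40ⁿ/(n+1)²`, uniformly in `ℓ ≥ 1` and `s ≤ 2`

The registered stubs `stub_coeffExists/Majorant/seriesChain` (lead c2, skeleton v4) encode the
recessive seed `W₀ = −(ℓ/r)·ω₀(M/r)`, `ω₀ = Σ Ωₙ wⁿ`, of the Regge–Wheeler chain by the triangular
recursion (all `n`)

  `ℓ² Σ_{i ≤ n} Ωᵢ Ω_{n−i} + ℓ((n+1)Ωₙ − 2n Ω_{n−1}) = rhsₙ`,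
  `rhs₀ = ℓ(ℓ+1)`, `rhs₁ = 2(1−s²) − 2ℓ(ℓ+1)`, `rhs₂ = −4(1−s²)`, `rhsₙ = 0` (`n ≥ 3`), `Ω₀ = 1`.

At order `n ≥ 1` the pivot is `ℓ(2ℓ+n+1)` (`rung0_pivot`), so EVERY solution obeys
`|Ωₙ| ≤ 2|Ω_{n−1}| + ½ Σ_{0<i<n}|Ωᵢ||Ω_{n−i}|` for `n ≥ 3`, with `|Ω₁| ≤ 2`, `|Ω₂| ≤ 5`; the profile
`Pₙ = (1/5)·40ⁿ/(n+1)²` is a majorant (`rung0_abs_le_profile`) by the classical convolution estimate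
`Σ_{0<i<n} 1/((i+1)²(n−i+1)²) ≤ 4/(n+2)²` (`conv_inv_sq_le`), whence `|Ωₙ| ≤ 40ⁿ`
(`rung0_abs_le_pow`) — the `ℓ`-free rung-0 input ("A0") of Theorem A of the line's plan
(`Cruxes/UniformPhotonSphereChannelsR/NOTES.md` §§7–15, R-proof-c1).  The inversion `g = 1/ω` and
the packaging for the registered two-index arrays are in `…RCoeffRungZeroInversion`.
(Truth, for comparison: `|Ωₙ|^{1/n} ≤ 1.72`, radius = the horizon `w = 1/2`; the statement is `∃K`.)
-/

-- `Summit.<S>.<S>` repeats a namespace component by design (D-0017); off here as in the lakefile.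
set_option linter.dupNamespace false

noncomputable section

namespace Summit.FinalStateConjecture.FinalStateConjecture.Theorems.CrumPeelingRecessiveTower

open Finset

/-! ### Convolution tools -/

/-- `Σ_{i<m} 1/(i+2)² ≤ 1` (telescoping against `1/((i+1)(i+2))`). -/
theorem sum_inv_sq_shift_le_one (m : ℕ) :
    ∑ i ∈ range m, (1 : ℝ) / ((i : ℝ) + 2) ^ 2 ≤ 1 := by
  have key : ∀ m : ℕ, ∑ i ∈ range m, (1 : ℝ) / ((i : ℝ) + 2) ^ 2 ≤ 1 - 1 / ((m : ℝ) + 1) := by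
    intro m
    induction m with
    | zero => simp
    | succ m ih =>
      rw [sum_range_succ]
      have hm : (0 : ℝ) < (m : ℝ) + 1 := by positivity
      have hm2 : (0 : ℝ) < (m : ℝ) + 2 := by positivity
      -- 1/(m+2)² ≤ 1/(m+1) − 1/(m+2)
      have hstep : (1 : ℝ) / ((m : ℝ) + 2) ^ 2 ≤ 1 / ((m : ℝ) + 1) - 1 / ((m : ℝ) + 2) := by
        rw [div_sub_div _ _ hm.ne' hm2.ne', div_le_div_iff₀ (by positivity) (by positivity)]
        nlinarith
      push_cast
      have e : ((m : ℝ) + 1 + 1) = (m : ℝ) + 2 := by ring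
      rw [e]
      linarith
  have h := key m
  have : 0 ≤ 1 / ((m : ℝ) + 1) := by positivity
  linarith

/-- **The convolution estimate** `Σ_{i < n−1} 1/((i+2)²(n−i)²) ≤ 4/(n+2)²` (for every `n`; the
indices `i+2` and `n−i` sum to `n+2`). -/
theorem conv_inv_sq_le (n : ℕ) :
    ∑ i ∈ Finset.range (n - 1), (1 : ℝ) / (((i : ℝ) + 2) ^ 2 * ((n : ℝ) - i) ^ 2) ≤
      4 / ((n : ℝ) + 2) ^ 2 := by
  -- each term ≤ (2/(n+2)²) (1/(i+2)² + 1/(n−i)²)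
  have hterm : ∀ i ∈ range (n - 1),
      (1 : ℝ) / (((i : ℝ) + 2) ^ 2 * ((n : ℝ) - i) ^ 2) ≤
        2 / ((n : ℝ) + 2) ^ 2 * (1 / ((i : ℝ) + 2) ^ 2 + 1 / ((n : ℝ) - i) ^ 2) := by
    intro i hi
    rw [mem_range] at hi
    have hin : (i : ℝ) + 1 < n := by
      have : i + 1 < n := by omega
      exact_mod_cast this
    have ha : (0 : ℝ) < (i : ℝ) + 2 := by positivity
    have hb : (0 : ℝ) < (n : ℝ) - i := by linarith
    -- with a = i+2, b = n−i, a + b = n + 2: 1/(a²b²) = (1/a + 1/b)²/(a+b)² ≤ 2(1/a² + 1/b²)/(a+b)²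
    set a := (i : ℝ) + 2 with ha_def
    set b := (n : ℝ) - i with hb_def
    have hab : a + b = (n : ℝ) + 2 := by rw [ha_def, hb_def]; ring
    rw [← hab]
    have e1 : (1 : ℝ) / (a ^ 2 * b ^ 2) = (1 / a + 1 / b) ^ 2 / (a + b) ^ 2 := by
      field_simp
      ring
    rw [e1, div_le_iff₀ (by positivity), mul_comm (2 / (a + b) ^ 2), mul_assoc,
      div_mul_cancel₀ _ (by positivity)]
    -- (x + y)² ≤ 2(x² + y²)
    rw [show (1 : ℝ) / a ^ 2 = (1 / a) ^ 2 by rw [one_div_pow],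
      show (1 : ℝ) / b ^ 2 = (1 / b) ^ 2 by rw [one_div_pow]]
    nlinarith [sq_nonneg (1 / a - 1 / b)]
  refine (sum_le_sum hterm).trans ?_
  rw [← mul_sum, sum_add_distrib]
  -- the two partial sums are each ≤ 1 (the second after reflection i ↦ n − 2 − i)
  have h1 : ∑ i ∈ range (n - 1), (1 : ℝ) / ((i : ℝ) + 2) ^ 2 ≤ 1 := sum_inv_sq_shift_le_one _
  have h2 : ∑ i ∈ range (n - 1), (1 : ℝ) / ((n : ℝ) - i) ^ 2 ≤ 1 := by
    have href := sum_range_reflect (fun i => (1 : ℝ) / ((i : ℝ) + 2) ^ 2) (n - 1)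
    -- Σ_{j<n−1} f(n−1−1−j) = Σ_{j<n−1} f j  with f j = 1/(j+2)²; and n−2−j+2 = n − j
    have e : ∑ j ∈ range (n - 1), (1 : ℝ) / ((n : ℝ) - j) ^ 2 =
        ∑ j ∈ range (n - 1), (1 : ℝ) / ((((n - 1 - 1 - j : ℕ)) : ℝ) + 2) ^ 2 := by
      apply sum_congr rfl
      intro j hj
      rw [mem_range] at hj
      have : ((n - 1 - 1 - j : ℕ) : ℝ) + 2 = (n : ℝ) - j := by
        have h' : j + 2 ≤ n := by omega
        rw [show n - 1 - 1 - j = n - (j + 2) by omega]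
        push_cast [Nat.cast_sub h']
        ring
      rw [this]
    rw [e, href]
    exact sum_inv_sq_shift_le_one _
  have hpos : (0 : ℝ) ≤ 2 / ((n : ℝ) + 2) ^ 2 := by positivity
  calc 2 / ((n : ℝ) + 2) ^ 2 *
        (∑ i ∈ range (n - 1), (1 : ℝ) / ((i : ℝ) + 2) ^ 2 + ∑ i ∈ range (n - 1), 1 / ((n : ℝ) - i) ^ 2)
      ≤ 2 / ((n : ℝ) + 2) ^ 2 * (1 + 1) := by
        apply mul_le_mul_of_nonneg_left _ hpos; linarith
    _ = 4 / ((n : ℝ) + 2) ^ 2 := by ring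

/-! ### The rung-0 recursion: pivot form and the majorant -/

/-- The right-hand side of the registered rung-0 recursion. -/
def rung0Rhs (s ℓ n : ℕ) : ℝ :=
  if n = 0 then (ℓ : ℝ) * ((ℓ : ℝ) + 1)
  else if n = 1 then 2 * (1 - (s : ℝ) ^ 2) - 2 * ((ℓ : ℝ) * ((ℓ : ℝ) + 1))
  else if n = 2 then -(4 * (1 - (s : ℝ) ^ 2)) else 0

/-- The majorant profile `Pₙ = (1/5)·40ⁿ/(n+1)²`. -/
def rung0Profile (n : ℕ) : ℝ := (1 / 5) * 40 ^ n / ((n : ℝ) + 1) ^ 2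

/-- The profile is positive. -/
theorem rung0Profile_pos (n : ℕ) : 0 < rung0Profile n := by
  unfold rung0Profile; positivity

/-- **Pivot form** of the rung-0 recursion at order `m + 1`:
`ℓ(2ℓ + m + 2) Ω_{m+1} = rhs_{m+1} + 2ℓ(m+1) Ω_m − ℓ² Σ_{i<m} Ω_{i+1} Ω_{m−i}` (uses `Ω₀ = 1`). -/
theorem rung0_pivot {s ℓ : ℕ} {Ω : ℕ → ℝ} (hΩ0 : Ω 0 = 1)
    (hrec : ∀ n, (ℓ : ℝ) ^ 2 * ∑ i ∈ range (n + 1), Ω i * Ω (n - i)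
        + (ℓ : ℝ) * (((n : ℝ) + 1) * Ω n - 2 * (n : ℝ) * Ω (n - 1)) = rung0Rhs s ℓ n)
    (m : ℕ) :
    (ℓ : ℝ) * (2 * ℓ + m + 2) * Ω (m + 1) =
      rung0Rhs s ℓ (m + 1) + 2 * ℓ * ((m : ℝ) + 1) * Ω m
        - (ℓ : ℝ) ^ 2 * ∑ i ∈ range m, Ω (i + 1) * Ω (m - i) := by
  have h := hrec (m + 1)
  rw [sum_range_succ, sum_range_succ'] at h
  simp only [Nat.sub_self, Nat.sub_zero, Nat.add_sub_cancel, hΩ0, mul_one, one_mul] at h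
  have e : ∀ i ∈ range m, Ω (i + 1) * Ω (m + 1 - (i + 1)) = Ω (i + 1) * Ω (m - i) := by
    intro i hi
    rw [show m + 1 - (i + 1) = m - i by omega]
  rw [sum_congr rfl e] at h
  push_cast at h
  linear_combination h

/-- `|rhs_{m+1}|` is `≤ 6 + 2ℓ(ℓ+1)` at `m = 0`, `≤ 12` at `m = 1`, and `0` beyond, for `s ≤ 2`. -/
theorem rung0Rhs_succ_succ_succ (s ℓ m : ℕ) : rung0Rhs s ℓ (m + 3) = 0 := by
  unfold rung0Rhs
  simp

set_option maxHeartbeats 400000 in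
/-- **The majorant**: every solution of the rung-0 recursion with `Ω₀ = 1` (`ℓ ≥ 1`, `s ≤ 2`)
satisfies `|Ω_{m+1}| ≤ P_{m+1} = (1/5)·40^{m+1}/(m+2)²` for all `m`. -/
theorem rung0_abs_le_profile {s ℓ : ℕ} (hs : s ≤ 2) (hℓ : 1 ≤ ℓ) {Ω : ℕ → ℝ} (hΩ0 : Ω 0 = 1)
    (hrec : ∀ n, (ℓ : ℝ) ^ 2 * ∑ i ∈ range (n + 1), Ω i * Ω (n - i)
        + (ℓ : ℝ) * (((n : ℝ) + 1) * Ω n - 2 * (n : ℝ) * Ω (n - 1)) = rung0Rhs s ℓ n) :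
    ∀ m, |Ω (m + 1)| ≤ rung0Profile (m + 1) := by
  have hℓr : (1 : ℝ) ≤ ℓ := by exact_mod_cast hℓ
  have hsr : (s : ℝ) ≤ 2 := by exact_mod_cast hs
  have hs0 : (0 : ℝ) ≤ s := Nat.cast_nonneg s
  have hβ : |1 - (s : ℝ) ^ 2| ≤ 3 := by
    rw [abs_le]; constructor <;> nlinarith
  intro m
  induction m using Nat.strong_induction_on with
  | _ m ih =>
    have hpiv := rung0_pivot (s := s) hΩ0 hrec m
    have hp : (0 : ℝ) < (ℓ : ℝ) * (2 * ℓ + m + 2) := by positivity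
    rcases m with _ | _ | m
    · -- n = 1
      simp only [range_zero, sum_empty, mul_zero, sub_zero, Nat.cast_zero] at hpiv
      rw [hΩ0] at hpiv
      norm_num [rung0Rhs] at hpiv
      -- hpiv : ℓ(2ℓ+0+2) Ω 1 = 2(1−s²) − 2ℓ(ℓ+1) + 2ℓ
      obtain ⟨hβl, hβu⟩ := abs_le.1 hβ
      have hp' : (0 : ℝ) < (ℓ : ℝ) * (2 * ℓ + 2) := by positivity
      have hup : (ℓ : ℝ) * (2 * ℓ + 2) * Ω 1 ≤ (ℓ : ℝ) * (2 * ℓ + 2) * 2 := by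
        rw [hpiv]; nlinarith
      have hlo : (ℓ : ℝ) * (2 * ℓ + 2) * (-2) ≤ (ℓ : ℝ) * (2 * ℓ + 2) * Ω 1 := by
        rw [hpiv]; nlinarith
      have h1 : Ω 1 ≤ 2 := le_of_mul_le_mul_left hup hp'
      have h2 : -2 ≤ Ω 1 := le_of_mul_le_mul_left hlo hp'
      show |Ω (0 + 1)| ≤ rung0Profile (0 + 1)
      unfold rung0Profile
      norm_num
      exact abs_le.2 ⟨h2, h1⟩
    · -- n = 2
      norm_num [rung0Rhs, Finset.sum_range_one] at hpiv
      -- hpiv : ℓ(2ℓ+3) Ω 2 = −4(1−s²) + 2ℓ·2·Ω 1 − ℓ² (Ω 1 · Ω 1)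
      have h1 : |Ω 1| ≤ 2 := by
        have := ih 0 (by omega)
        unfold rung0Profile at this
        norm_num at this
        exact this
      obtain ⟨h1l, h1u⟩ := abs_le.1 h1
      obtain ⟨hβl, hβu⟩ := abs_le.1 hβ
      have hp' : (0 : ℝ) < (ℓ : ℝ) * (2 * ℓ + 3) := by positivity
      have hℓ0 : (0 : ℝ) ≤ ℓ := by positivity
      have hsq : 0 ≤ Ω 1 * Ω 1 := mul_self_nonneg _
      have hsq4 : Ω 1 * Ω 1 ≤ 4 := by nlinarith
      have hA : 2 * (ℓ : ℝ) * 2 * Ω 1 ≤ 8 * ℓ := by nlinarith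
      have hA' : -(8 * (ℓ : ℝ)) ≤ 2 * (ℓ : ℝ) * 2 * Ω 1 := by nlinarith
      have hB : (ℓ : ℝ) ^ 2 * (Ω 1 * Ω 1) ≤ 4 * (ℓ : ℝ) ^ 2 := by nlinarith
      have hB' : 0 ≤ (ℓ : ℝ) ^ 2 * (Ω 1 * Ω 1) := by positivity
      have hpiv2 : (ℓ : ℝ) * (2 * ℓ + 3) * Ω 2 =
          -(4 * (1 - (s : ℝ) ^ 2)) + 2 * ↑ℓ * 2 * Ω 1 - (ℓ : ℝ) ^ 2 * (Ω 1 * Ω 1) := by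
        rw [← hpiv]; ring
      have hup : (ℓ : ℝ) * (2 * ℓ + 3) * Ω 2 ≤ (ℓ : ℝ) * (2 * ℓ + 3) * 5 := by
        rw [hpiv2]; nlinarith
      have hlo : (ℓ : ℝ) * (2 * ℓ + 3) * (-5) ≤ (ℓ : ℝ) * (2 * ℓ + 3) * Ω 2 := by
        rw [hpiv2]; nlinarith
      have h2u : Ω 2 ≤ 5 := le_of_mul_le_mul_left hup hp'
      have h2l : -5 ≤ Ω 2 := le_of_mul_le_mul_left hlo hp'
      show |Ω (1 + 1)| ≤ rung0Profile (1 + 1)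
      unfold rung0Profile
      norm_num
      have : |Ω 2| ≤ 5 := abs_le.2 ⟨h2l, h2u⟩
      linarith
    · -- n = m + 3 ≥ 3: rhs = 0, induction hypothesis on all lower orders
      set n := m + 2 with hn  -- so the order is n + 1 = m + 3, previous order n = m + 2
      rw [show m + 2 + 1 = n + 1 by omega] at *
      have hrhs : rung0Rhs s ℓ (n + 1) = 0 := by
        rw [show n + 1 = m + 3 by omega]; exact rung0Rhs_succ_succ_succ s ℓ m
      rw [hrhs, zero_add] at hpiv
      -- bounds on the lower orders
      have hprev : |Ω n| ≤ rung0Profile n := by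
        have := ih (m + 1) (by omega)
        rwa [show m + 1 + 1 = n by omega] at this
      have hconv : |∑ i ∈ range n, Ω (i + 1) * Ω (n - i)| ≤
          (1 / 25) * 40 ^ (n + 1) * (4 / ((n : ℝ) + 3) ^ 2) := by
        refine (abs_sum_le_sum_abs _ _).trans ?_
        have hterm : ∀ i ∈ range n, |Ω (i + 1) * Ω (n - i)| ≤
            (1 / 25) * 40 ^ (n + 1) * (1 / (((i : ℝ) + 2) ^ 2 * (((n + 1 : ℕ) : ℝ) - i) ^ 2)) := by
          intro i hi
          rw [mem_range] at hi
          rw [abs_mul]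
          have hi1 : |Ω (i + 1)| ≤ rung0Profile (i + 1) := ih i (by omega)
          have hi2 : |Ω (n - i)| ≤ rung0Profile (n - i) := by
            have := ih (n - i - 1) (by omega)
            rwa [show n - i - 1 + 1 = n - i by omega] at this
          refine (mul_le_mul hi1 hi2 (abs_nonneg _) (rung0Profile_pos _).le).trans (le_of_eq ?_)
          unfold rung0Profile
          have hcast : ((n - i : ℕ) : ℝ) = (n : ℝ) - i := by
            rw [Nat.cast_sub (by omega)]
          rw [hcast]
          push_cast
          have hpow : (40 : ℝ) ^ (i + 1) * 40 ^ (n - i) = 40 ^ (n + 1) := by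
            rw [← pow_add]; congr 1; omega
          field_simp
          rw [← hpow]
          ring
        refine (sum_le_sum hterm).trans ?_
        rw [← mul_sum]
        apply mul_le_mul_of_nonneg_left _ (by positivity)
        have hc := conv_inv_sq_le (n + 1)
        rw [show n + 1 - 1 = n by omega] at hc
        push_cast at hc ⊢
        rw [show (n : ℝ) + 1 + 2 = (n : ℝ) + 3 by ring] at hc
        exact hc
      -- assemble: ℓ(2ℓ+n+2) |Ω (n+1)| ≤ 2ℓ(n+1) Pₙ + ℓ² · conv
      have hmain : (ℓ : ℝ) * (2 * ℓ + n + 2) * |Ω (n + 1)| ≤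
          2 * ℓ * ((n : ℝ) + 1) * rung0Profile n
            + (ℓ : ℝ) ^ 2 * ((1 / 25) * 40 ^ (n + 1) * (4 / ((n : ℝ) + 3) ^ 2)) := by
        have e : (ℓ : ℝ) * (2 * ℓ + n + 2) * |Ω (n + 1)| = |(ℓ : ℝ) * (2 * ℓ + n + 2) * Ω (n + 1)| := by
          rw [abs_mul, abs_of_pos hp]
        rw [e, hpiv]
        refine (abs_sub _ _).trans ?_
        have h1 : |2 * ↑ℓ * ((n : ℝ) + 1) * Ω n| ≤ 2 * ℓ * ((n : ℝ) + 1) * rung0Profile n := by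
          rw [abs_mul, abs_of_nonneg (by positivity : (0:ℝ) ≤ 2 * ↑ℓ * ((n : ℝ) + 1))]
          exact mul_le_mul_of_nonneg_left hprev (by positivity)
        have h2 : |(ℓ : ℝ) ^ 2 * ∑ i ∈ range n, Ω (i + 1) * Ω (n - i)| ≤
            (ℓ : ℝ) ^ 2 * ((1 / 25) * 40 ^ (n + 1) * (4 / ((n : ℝ) + 3) ^ 2)) := by
          rw [abs_mul, abs_of_nonneg (by positivity : (0:ℝ) ≤ (ℓ : ℝ) ^ 2)]
          exact mul_le_mul_of_nonneg_left hconv (by positivity)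
        linarith
      -- divide by the pivot, using 2ℓ(n+1)/(ℓ(2ℓ+n+2)) ≤ 2 and ℓ²/(ℓ(2ℓ+n+2)) ≤ 1/2
      have hA : 2 * ℓ * ((n : ℝ) + 1) * rung0Profile n ≤
          (ℓ : ℝ) * (2 * ℓ + n + 2) * (2 * rung0Profile n) := by
        have := rung0Profile_pos n
        nlinarith
      have hB : (ℓ : ℝ) ^ 2 * ((1 / 25) * 40 ^ (n + 1) * (4 / ((n : ℝ) + 3) ^ 2)) ≤
          (ℓ : ℝ) * (2 * ℓ + n + 2) * ((1 / 2) * ((1 / 25) * 40 ^ (n + 1) * (4 / ((n : ℝ) + 3) ^ 2))) := by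
        have hX : (0 : ℝ) ≤ (1 / 25) * 40 ^ (n + 1) * (4 / ((n : ℝ) + 3) ^ 2) := by positivity
        have hl2 : (ℓ : ℝ) ^ 2 ≤ (ℓ : ℝ) * (2 * ℓ + n + 2) * (1 / 2) := by
          have : (0 : ℝ) ≤ n := Nat.cast_nonneg n
          nlinarith
        calc (ℓ : ℝ) ^ 2 * ((1 / 25) * 40 ^ (n + 1) * (4 / ((n : ℝ) + 3) ^ 2))
            ≤ (ℓ : ℝ) * (2 * ℓ + n + 2) * (1 / 2) * ((1 / 25) * 40 ^ (n + 1) * (4 / ((n : ℝ) + 3) ^ 2)) :=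
              mul_le_mul_of_nonneg_right hl2 hX
          _ = _ := by ring
      have hdiv : |Ω (n + 1)| ≤ 2 * rung0Profile n + (1 / 2) * ((1 / 25) * 40 ^ (n + 1) * (4 / ((n : ℝ) + 3) ^ 2)) := by
        have h := hmain.trans (add_le_add hA hB)
        rw [← mul_add] at h
        exact le_of_mul_le_mul_left h hp
      -- the profile inequality: 2 Pₙ + (2/25) 40^{n+1}/(n+3)² ≤ P_{n+1}
      refine hdiv.trans ?_
      unfold rung0Profile
      have hn3 : (2 : ℝ) ≤ n := by
        have : 2 ≤ n := by omega
        exact_mod_cast this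
      have hpw : (40 : ℝ) ^ (n + 1) = 40 * 40 ^ n := by rw [pow_succ]; ring
      rw [hpw]
      have hq : (0 : ℝ) < 40 ^ n := by positivity
      -- reduce to (2/5)/(n+1)² + (16/5)/(n+3)² ≤ 8/(n+2)²
      have key : (2 / 5) / ((n : ℝ) + 1) ^ 2 + (16 / 5) / ((n : ℝ) + 3) ^ 2 ≤ 8 / ((n : ℝ) + 2) ^ 2 := by
        have hA : (0 : ℝ) < ((n : ℝ) + 1) ^ 2 := by positivity
        have hB : (0 : ℝ) < ((n : ℝ) + 3) ^ 2 := by positivity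
        have hC : (0 : ℝ) < ((n : ℝ) + 2) ^ 2 := by positivity
        rw [div_add_div _ _ hA.ne' hB.ne', div_le_div_iff₀ (mul_pos hA hB) hC]
        nlinarith [mul_nonneg (mul_nonneg hA.le hB.le) hC.le, sq_nonneg ((n:ℝ) - 2),
          mul_nonneg (sub_nonneg.2 hn3) hA.le]
      have e : 2 * (1 / 5 * 40 ^ n / ((n : ℝ) + 1) ^ 2) +
          1 / 2 * (1 / 25 * (40 * 40 ^ n) * (4 / ((n : ℝ) + 3) ^ 2)) =
          40 ^ n * ((2 / 5) / ((n : ℝ) + 1) ^ 2 + (16 / 5) / ((n : ℝ) + 3) ^ 2) := by ring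
      have e2 : 1 / 5 * (40 * 40 ^ n) / (((n + 1 : ℕ) : ℝ) + 1) ^ 2 = 40 ^ n * (8 / ((n : ℝ) + 2) ^ 2) := by
        push_cast; ring
      rw [e, e2]
      exact mul_le_mul_of_nonneg_left key hq.le

/-- **Exported form**: `|Ωₙ| ≤ 40ⁿ` for every `n` (rung 0, any `ℓ ≥ 1`, `s ≤ 2`). -/
theorem rung0_abs_le_pow {s ℓ : ℕ} (hs : s ≤ 2) (hℓ : 1 ≤ ℓ) {Ω : ℕ → ℝ} (hΩ0 : Ω 0 = 1)
    (hrec : ∀ n, (ℓ : ℝ) ^ 2 * ∑ i ∈ range (n + 1), Ω i * Ω (n - i)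
        + (ℓ : ℝ) * (((n : ℝ) + 1) * Ω n - 2 * (n : ℝ) * Ω (n - 1)) = rung0Rhs s ℓ n) (n : ℕ) :
    |Ω n| ≤ 40 ^ n := by
  rcases n with _ | m
  · rw [hΩ0]; simp
  · refine (rung0_abs_le_profile hs hℓ hΩ0 hrec m).trans ?_
    unfold rung0Profile
    rw [div_le_iff₀ (by positivity)]
    have h1 : (1 : ℝ) ≤ ((((m + 1 : ℕ)) : ℝ) + 1) ^ 2 := by
      have h0 : (0 : ℝ) ≤ (((m + 1 : ℕ)) : ℝ) := by positivity
      nlinarith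
    have hq : (0 : ℝ) < 40 ^ (m + 1) := by positivity
    nlinarith


end Summit.FinalStateConjecture.FinalStateConjecture.Theorems.CrumPeelingRecessiveTower
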